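import Mathlib
import Summits.Ventures.PercRepro2.Tail2DBlockCalc
import Summits.Ventures.PercRepro2.Tail2DHarrisSP
import Summits.Ventures.PercRepro2.Tail2DFlowOneBlocks
import Summits.Ventures.PercRepro2.Tail2DFlowOneStep01
import Summits.Ventures.PercRepro2.Tail2DParFin
import Summits.Ventures.PercRepro2.Tail2DParFinFlip
import Summits.Ventures.PercRepro2.Tail2DParFinTop
import Summits.Ventures.PercRepro2.Tail2DParFinCount
import Summits.Ventures.PercRepro2.Tail2DParFinRelax

/-!
# (SD) at the sub-top level `u + v = k − 1` on `k` flow-one factors: the one-change certificate, part I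
(seat mine-b, cell pub-perc-repro2; conjectures/MINE-B.md §44)

At a sub-top position (`u + v + 1 = k`, `u ≥ v + 2`) every source configuration either STAYS, or FLIPS one red
factor (`R → B`), or RELAXES one red factor (`R → col = C ⊔ B`): the bottom words (`v` blues) flip a uniformly random
red; a common word (`v + 1` blues, `u` reds, no `C`) stays with probability `ι = λ − (v+1)/(u+1)`, relaxes each red at
rate `ξ = λ − (v+1)/u` and flips the red `i` at rate `(1−ι)/u − ξ − (ξ/k)(Γ_ρ(w) + (v+1)γ_i)` with `γ_i = #C_i/#R_i`
and `Γ_ρ(w) = Σ_{i red} γ_i` — the flips absorb the word-dependent cost of the relaxes.  This file: the index set,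
the blocks, the weights, their non-negativity (from the closed forms of the two tail counts), the dominations and
the source coverage.
-/

namespace Summit.Ventures.PercRepro2.Tail2D

open V2Closure Finset

section Rates

variable (k : ℕ) (X : Fin k → V2Closure.SP) (u v : ℕ)

/-- `γ_i = #C_i / #R_i` -/
noncomputable def gam (i : Fin k) : ℚ := ((cellSet (X i)).card : ℚ) / ((rSet (X i)).card : ℚ)

/-- `Γ_ρ(w) = Σ_{i red in w} γ_i` -/
noncomputable def gamRed (w : Fin k → Ltr) : ℚ := ∑ i ∈ redSet k w, gam k X i

/-- `x = Γ / k` -/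
noncomputable def gx : ℚ := (∑ i, gam k X i) / k

/-- `λ = |E(u,v)| / |E(u−1,v+1)|` -/
noncomputable def lamQ : ℚ :=
  (tailCount (parFin k X) u v : ℚ) / (tailCount (parFin k X) (u - 1) (v + 1) : ℚ)

/-- the identity rate `ι = λ − (v+1)/(u+1)` -/
noncomputable def iotaQ : ℚ := lamQ k X u v - (v + 1) / (u + 1)

/-- the relax rate `ξ = λ − (v+1)/u` -/
noncomputable def xiQ : ℚ := lamQ k X u v - (v + 1) / u

/-- the flip rate of a common word at its red `i` -/
noncomputable def flQ (w : Fin k → Ltr) (i : Fin k) : ℚ :=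
  (1 - iotaQ k X u v) / u - xiQ k X u v - xiQ k X u v / k * (gamRed k X w + (v + 1) * gam k X i)

/-- `γ_i ≥ 0` -/
theorem gam_nonneg (i : Fin k) : 0 ≤ gam k X i := by unfold gam; positivity

/-- `Γ_ρ(w) ≥ 0` -/
theorem gamRed_nonneg (w : Fin k → Ltr) : 0 ≤ gamRed k X w :=
  Finset.sum_nonneg (fun i _ => gam_nonneg k X i)

/-- `x ≥ 0` -/
theorem gx_nonneg : 0 ≤ gx k X := by unfold gx; exact div_nonneg (Finset.sum_nonneg (fun i _ => gam_nonneg k X i)) (by positivity)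

/-- `γ_i ≤ Γ` -/
theorem gam_le_sum (i : Fin k) : gam k X i ≤ ∑ j, gam k X j :=
  Finset.single_le_sum (fun j _ => gam_nonneg k X j) (Finset.mem_univ i)

/-- `Γ_ρ(w) ≤ Γ` -/
theorem gamRed_le_sum (w : Fin k → Ltr) : gamRed k X w ≤ ∑ j, gam k X j :=
  Finset.sum_le_sum_of_subset_of_nonneg (Finset.subset_univ _) (fun j _ _ => gam_nonneg k X j)

/-- `Γ̃ = A · Γ` when every factor has a red crossing -/
theorem massG_eq (hR : ∀ i, 0 < (rSet (X i)).card) : massG k X = massA k X * ∑ i, gam k X i := by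
  unfold massG massA gam
  rw [Finset.mul_sum]
  refine Finset.sum_congr rfl (fun l _ => ?_)
  have hl : ((rSet (X l)).card : ℚ) ≠ 0 := by exact_mod_cast (hR l).ne'
  have hprod : (∏ i, ((rSet (X i)).card : ℚ)) = ((rSet (X l)).card : ℚ) * ∏ i ∈ ({l} : Finset (Fin k))ᶜ, ((rSet (X i)).card : ℚ) := by
    rw [← Finset.prod_mul_prod_compl ({l} : Finset (Fin k)), Finset.prod_singleton]
  rw [hprod]
  field_simp

/-- `A > 0` when every factor has a red crossing -/
theorem massA_pos (hR : ∀ i, 0 < (rSet (X i)).card) : 0 < massA k X := by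
  unfold massA
  exact Finset.prod_pos (fun i _ => by exact_mod_cast hR i)

/-- **`λ = N/D`** at the sub-top level -/
theorem lamQ_eq (hX : ∀ i, FlowOne (X i)) (hR : ∀ i, 0 < (rSet (X i)).card) (hk : u + v + 1 = k) (hu : 1 ≤ u) :
    lamQ k X u v = subN u v (gx k X) / subD u v (gx k X) := by
  subst hk
  have hk' : (u - 1) + (v + 1) + 1 = u + v + 1 := by omega
  unfold lamQ
  rw [tailCount_subtop _ X hX u v rfl, tailCount_subtop _ X hX (u - 1) (v + 1) hk', massG_eq _ X hR]
  have hA := massA_pos _ X hR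
  set A := massA (u + v + 1) X with hA'
  set G := ∑ i, gam (u + v + 1) X i with hG
  have hG0 : 0 ≤ G := Finset.sum_nonneg (fun i _ => gam_nonneg _ X i)
  -- the binomial relations
  have r1 : ((u + v + 1).choose (v + 1) : ℚ) * (v + 1) = ((u + v + 1).choose v : ℚ) * (u + 1) := by
    have := Nat.choose_succ_right_eq (u + v + 1) v
    have e : u + v + 1 - v = u + 1 := by omega
    rw [e] at this
    exact_mod_cast this
  have r2 : ((u + v + 1).choose (v + 2) : ℚ) * (v + 2) = ((u + v + 1).choose (v + 1) : ℚ) * u := by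
    have := Nat.choose_succ_right_eq (u + v + 1) (v + 1)
    have e : u + v + 1 - (v + 1) = u := by omega
    rw [e] at this
    exact_mod_cast this
  have r3 : ((u + v + 1 : ℕ) : ℚ) * ((u + v + 1 - 1).choose v : ℚ) = ((u + v + 1).choose (v + 1) : ℚ) * (v + 1) := by
    have := Nat.add_one_mul_choose_eq (u + v) v
    have e : u + v + 1 - 1 = u + v := by omega
    rw [e]
    exact_mod_cast this
  have r4 : ((u + v + 1 - 1).choose (v + 1) : ℚ) * (v + 1) = ((u + v + 1 - 1).choose v : ℚ) * u := by
    have := Nat.choose_succ_right_eq (u + v) v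
    have e : u + v - v = u := by omega
    have e' : u + v + 1 - 1 = u + v := by omega
    rw [e] at this
    rw [e']
    exact_mod_cast this
  set P := ((u + v + 1).choose (v + 1) : ℚ) with hP
  have hPpos : 0 < P := by rw [hP]; exact_mod_cast Nat.choose_pos (by omega)
  have hE : A * (((u + v + 1).choose v : ℚ) + P) + A * G * ((u + v + 1 - 1).choose v : ℚ)
      = P * A * subN u v (gx (u + v + 1) X) := by
    unfold subN gx
    rw [← hG]
    have hu' : (u : ℚ) + 1 ≠ 0 := by positivity
    have hk0 : ((u + v + 1 : ℕ) : ℚ) ≠ 0 := by positivity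
    have c1 : ((u + v + 1).choose v : ℚ) = P * (v + 1) / (u + 1) := by
      rw [eq_div_iff hu']; linarith [r1]
    have c3 : ((u + v + 1 - 1).choose v : ℚ) = P * (v + 1) / ((u + v + 1 : ℕ) : ℚ) := by
      rw [eq_div_iff hk0]; linarith [r3]
    rw [c1, c3]
    field_simp
    push_cast
    ring
  have hE' : A * (P + ((u + v + 1).choose (v + 2) : ℚ)) + A * G * ((u + v + 1 - 1).choose (v + 1) : ℚ)
      = P * A * subD u v (gx (u + v + 1) X) := by
    unfold subD gx
    rw [← hG]
    have hv' : (v : ℚ) + 2 ≠ 0 := by positivity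
    have hv1 : (v : ℚ) + 1 ≠ 0 := by positivity
    have hk0 : ((u + v + 1 : ℕ) : ℚ) ≠ 0 := by positivity
    have c2 : ((u + v + 1).choose (v + 2) : ℚ) = P * u / (v + 2) := by
      rw [eq_div_iff hv']; linarith [r2]
    have c3 : ((u + v + 1 - 1).choose v : ℚ) = P * (v + 1) / ((u + v + 1 : ℕ) : ℚ) := by
      rw [eq_div_iff hk0]; linarith [r3]
    have c4 : ((u + v + 1 - 1).choose (v + 1) : ℚ) = P * u / ((u + v + 1 : ℕ) : ℚ) := by
      rw [eq_div_iff hk0]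
      have := r4
      rw [c3] at this
      field_simp at this
      linarith [this]
    rw [c2, c4]
    field_simp
    push_cast
    ring
  rw [hE, hE']
  have hD := subD_pos u v (gx (u + v + 1) X) (gx_nonneg _ X)
  rw [mul_div_mul_left _ _ (by positivity)]


/-- the two tail counts of the sub-top level are positive -/
theorem tailCount_subtop_pos (hX : ∀ i, FlowOne (X i)) (hR : ∀ i, 0 < (rSet (X i)).card) (hk : u + v + 1 = k) :
    0 < (tailCount (parFin k X) u v : ℚ) := by
  rw [tailCount_subtop k X hX u v hk]
  have hA := massA_pos k X hR
  have hG : 0 ≤ massG k X := by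
    unfold massG; exact Finset.sum_nonneg (fun l _ => by positivity)
  have hc : (0 : ℚ) < k.choose (v + 1) := by exact_mod_cast Nat.choose_pos (by omega)
  have hc' : (0 : ℚ) ≤ k.choose v := by positivity
  have hc'' : (0 : ℚ) ≤ (k - 1).choose v := by positivity
  nlinarith [mul_nonneg hG hc'', mul_nonneg hA.le hc']

variable {k X u v}

/-- the rates at the sub-top level, from `λ = N/D`: `ξ ≥ 0` -/
theorem xiQ_nonneg (hX : ∀ i, FlowOne (X i)) (hR : ∀ i, 0 < (rSet (X i)).card) (hk : u + v + 1 = k)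
    (huv : v + 2 ≤ u) : 0 ≤ xiQ k X u v := by
  unfold xiQ
  rw [lamQ_eq k X u v hX hR hk (by omega)]
  exact sub_xi_nonneg u v (gx k X) (gx_nonneg k X) (by omega)

/-- `ι ≥ 0` -/
theorem iotaQ_nonneg (hX : ∀ i, FlowOne (X i)) (hR : ∀ i, 0 < (rSet (X i)).card) (hk : u + v + 1 = k)
    (huv : v + 2 ≤ u) : 0 ≤ iotaQ k X u v := by
  unfold iotaQ
  rw [lamQ_eq k X u v hX hR hk (by omega)]
  exact sub_iota_nonneg u v (gx k X) (gx_nonneg k X) (by omega)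

/-- the flip rates are non-negative -/
theorem flQ_nonneg (hX : ∀ i, FlowOne (X i)) (hR : ∀ i, 0 < (rSet (X i)).card) (hk : u + v + 1 = k)
    (huv : v + 2 ≤ u) (w : Fin k → Ltr) (i : Fin k) : 0 ≤ flQ k X u v w i := by
  have hxi := xiQ_nonneg hX hR hk huv
  have hmargin := sub_flip_margin u v (gx k X) (gx_nonneg k X) (by omega)
  rw [← lamQ_eq k X u v hX hR hk (by omega)] at hmargin
  have hkpos : (0 : ℚ) < k := by exact_mod_cast (show 0 < k by omega)
  have hbound : gamRed k X w + (v + 1) * gam k X i ≤ (v + 2) * gx k X * k := by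
    have h1 := gamRed_le_sum k X w
    have h2 := gam_le_sum k X i
    have e : (v + 2 : ℚ) * gx k X * k = (v + 2) * ∑ j, gam k X j := by
      unfold gx; field_simp
    rw [e]
    nlinarith [gam_nonneg k X i]
  unfold flQ
  have : xiQ k X u v / k * (gamRed k X w + (v + 1) * gam k X i) ≤ xiQ k X u v * ((v + 2) * gx k X) := by
    calc xiQ k X u v / k * (gamRed k X w + (v + 1) * gam k X i)
        ≤ xiQ k X u v / k * ((v + 2) * gx k X * k) := by
          apply mul_le_mul_of_nonneg_left hbound (by positivity)
      _ = xiQ k X u v * ((v + 2) * gx k X) := by field_simp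
  unfold iotaQ xiQ at this
  unfold iotaQ xiQ
  nlinarith [this, hmargin]

end Rates

section Certificate

variable (k : ℕ) (X : Fin k → V2Closure.SP) (u v : ℕ)

/-- a source word: `#R ≥ u`, `#B ≥ v` -/
abbrev stSrc (w : Fin k → Ltr) : Prop := u ≤ nR k w ∧ v ≤ nB k w
/-- a bottom word: a source word with exactly `v` blues -/
abbrev stBot (w : Fin k → Ltr) : Prop := stSrc k u v w ∧ nB k w = v
/-- a common word: a source word with exactly `v + 1` blues -/
abbrev stCom (w : Fin k → Ltr) : Prop := stSrc k u v w ∧ nB k w = v + 1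

/-- an identity index (`m = 0`): a common word -/
abbrev stId (w : Fin k → Ltr) (_i : Fin k) (m : Fin 3) : Prop := m = 0 ∧ stCom k u v w
/-- a flip index (`m = 1`): a source word and one of its reds -/
abbrev stFl (w : Fin k → Ltr) (i : Fin k) (m : Fin 3) : Prop := m = 1 ∧ stSrc k u v w ∧ w i = Ltr.R
/-- a relax index (`m = 2`): a common word and one of its reds -/
abbrev stRx (w : Fin k → Ltr) (i : Fin k) (m : Fin 3) : Prop := m = 2 ∧ stCom k u v w ∧ w i = Ltr.R

/-- the source block of an index -/
def stP (w : Fin k → Ltr) (i : Fin k) (m : Fin 3) : Finset (parFin k X).Conf :=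
  if stId k u v w i m ∨ stFl k u v w i m ∨ stRx k u v w i m then blockOf k X w else ∅

/-- the target block of an index -/
def stQ (w : Fin k → Ltr) (i : Fin k) (m : Fin 3) : Finset (parFin k X).Conf :=
  if stId k u v w i m then blockOf k X w
  else if stFl k u v w i m then blockOf k X (flipSet k w {i})
  else if stRx k u v w i m then blockCol k X w i else ∅

/-- the weight of an index -/
noncomputable def stW (w : Fin k → Ltr) (i : Fin k) (m : Fin 3) : ℚ :=
  if stId k u v w i m then iotaQ k X u v * (blockOf k X w).card / (tailCount (parFin k X) u v * k)
  else if stFl k u v w i m then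
    (if stBot k u v w then ((nR k w : ℚ))⁻¹ else flQ k X u v w i) * (blockOf k X w).card / tailCount (parFin k X) u v
  else if stRx k u v w i m then xiQ k X u v * (blockCol k X w i).card / tailCount (parFin k X) u v
  else 0

variable {k X u v}

/-- the weights are non-negative -/
theorem stW_nonneg (hX : ∀ i, FlowOne (X i)) (hR : ∀ i, 0 < (rSet (X i)).card) (hk : u + v + 1 = k)
    (huv : v + 2 ≤ u) (w : Fin k → Ltr) (i : Fin k) (m : Fin 3) : 0 ≤ stW k X u v w i m := by
  unfold stW
  have h1 := iotaQ_nonneg hX hR hk huv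
  have h2 := xiQ_nonneg hX hR hk huv
  have h3 := flQ_nonneg hX hR hk huv w i
  split_ifs <;> positivity

/-- every index is a product coupling -/
theorem stP_dom (hX : ∀ i, FlowOne (X i)) (w : Fin k → Ltr) (i : Fin k) (m : Fin 3) :
    BlockDom (parFin k X) (stP k X u v w i m) (stQ k X u v w i m) := by
  unfold stP stQ
  by_cases h1 : stId k u v w i m
  · rw [if_pos (Or.inl h1), if_pos h1]; exact blockDom_refl _ _
  · rw [if_neg h1]
    by_cases h2 : stFl k u v w i m
    · rw [if_pos (Or.inr (Or.inl h2)), if_pos h2]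
      apply blockOf_dom
      intro j
      by_cases hj : j = i
      · subst hj; right; exact ⟨h2.2.2, by simp [flipSet]⟩
      · left; simp [flipSet, hj]
    · rw [if_neg h2]
      by_cases h3 : stRx k u v w i m
      · rw [if_pos (Or.inr (Or.inr h3)), if_pos h3]
        exact blockDom_col k X hX w i h3.2.2
      · rw [if_neg (fun h => h.elim h1 (fun h => h.elim h2 h3)), if_neg h3]
        exact blockDom_refl _ _

/-- the block of a word without `C` is non-empty when every factor has a red crossing -/
theorem card_blockOf_pos_of_noC (hR : ∀ i, 0 < (rSet (X i)).card) (w : Fin k → Ltr) (hw : ∀ i, w i ≠ Ltr.C) :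
    0 < (blockOf k X w).card := by
  rw [card_blockOf]
  apply Finset.prod_pos
  intro i _
  cases hwi : w i
  · exact hR i
  · rw [show (letterSet (X i) Ltr.B).card = (letterSet (X i) Ltr.R).card from (card_letterSet_R_eq_B (X i)).symm]
    exact hR i
  · exact absurd hwi (hw i)

/-- a common word has no `C` -/
theorem stCom_noC (hk : u + v + 1 = k) (w : Fin k → Ltr) (hw : stCom k u v w) (i : Fin k) : w i ≠ Ltr.C := by
  intro hC
  have h3 := nR_add_nB_add_nC k w
  have : 0 < nC k w := by
    unfold nC
    apply Finset.card_pos.2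
    exact ⟨i, by simp [cSet, hC]⟩
  have := hw.1.1; have := hw.2
  omega

/-- a common word has exactly `u` reds -/
theorem stCom_nR (hk : u + v + 1 = k) (w : Fin k → Ltr) (hw : stCom k u v w) : nR k w = u := by
  have h3 := nR_add_nB_add_nC k w
  have : nC k w = 0 := by
    unfold nC
    rw [Finset.card_eq_zero, Finset.eq_empty_iff_forall_notMem]
    intro i hi
    simp only [cSet, Finset.mem_filter, Finset.mem_univ, true_and] at hi
    exact stCom_noC hk w hw i hi
  have := hw.1.1; have := hw.2
  omega

/-- a target block is non-empty when its source block is -/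
theorem stQ_nonempty (hX : ∀ i, FlowOne (X i)) (hR : ∀ i, 0 < (rSet (X i)).card) (hk : u + v + 1 = k)
    (w : Fin k → Ltr) (i : Fin k) (m : Fin 3) (_ : 0 < stW k X u v w i m)
    (hP : (stP k X u v w i m).Nonempty) : (stQ k X u v w i m).Nonempty := by
  unfold stP at hP
  unfold stQ
  by_cases h1 : stId k u v w i m
  · rw [if_pos (Or.inl h1)] at hP
    rw [if_pos h1]; exact hP
  · rw [if_neg h1]
    by_cases h2 : stFl k u v w i m
    · rw [if_pos (Or.inr (Or.inl h2))] at hP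
      rw [if_pos h2]
      apply Finset.card_pos.1
      rw [card_blockOf_flipSet k X w {i} (by
        intro j hj; rw [Finset.mem_singleton] at hj; subst hj
        simp [redSet, h2.2.2])]
      exact Finset.card_pos.2 hP
    · rw [if_neg h2]
      by_cases h3 : stRx k u v w i m
      · rw [if_pos h3]
        apply Finset.card_pos.1
        rw [card_blockCol k X hX]
        have : 0 < (blockOf k X (Function.update w i Ltr.B)).card := by
          apply card_blockOf_pos_of_noC hR
          intro j
          by_cases hj : j = i
          · subst hj; simp
          · rw [Function.update_of_ne hj]; exact stCom_noC hk w h3.2.1 j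
        omega
      · rw [if_neg (fun h => h.elim h1 (fun h => h.elim h2 h3))] at hP
        exact absurd hP Finset.not_nonempty_empty

end Certificate

end Summit.Ventures.PercRepro2.Tail2D
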